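import Summits.AtomisticToContinuum.HydrodynamicLimit.Theses.ImplosionDichotomy
import Literature.MathematicalPhysics.KineticTheory.HardSphereEulerLLN

/-!
# drefute gen 2 — STUB E2b `stub_eosCesaro` of line `log-lipschitz-budget` (crux stmt-AtomisticToContinuum-12587) is FALSE as typed

`StubEosCesaro` below is the statement of `stub_eosCesaro` (skeleton `Cruxes/PolynomialCompression/Lines/log-lipschitz-budget.lean`,
lead's cycle-2 reshape, sha256 18eca5c7956c…, lines 314–321) VERBATIM. It quantifies over every `Rf` that is merely continuous
with `1 ≤ Rf ≤ 2` on `[0, r]`; at `η = 0` its ratio-convergence hypothesis is guarded by `0 < η →` and hence VACUOUS, while the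
conclusion still asserts `−N⁻¹ log hsFreeVolume 0 N → ∫₀¹ log Rf(0) ds = log (Rf 0)`. Nothing pins `Rf 0 = 1`: instantiating
at `Rf ≡ 1` and at `Rf ≡ 2` (both legal, `r = 1`, `η = 0`) makes the SAME sequence converge to `0` and to `log 2` — absurd by
uniqueness of limits (no evaluation of `hsFreeVolume` is needed).

stub-misstated (the docstring's "at η = 0 … both sides are 0" silently assumes `Rf 0 = 1`, which the glue
`hsEosLowDensity_of_stubs` does have from STUB E1). Minimal repairs, either of which the glue already supplies:
(C′₁) add the hypothesis `Rf 0 = 1 →` (then at `η = 0` the claim is `−N⁻¹ log hsFreeVolume 0 N → 0`, true since the free volume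
at `η = 0` is `1`: pairwise-distinct configurations have full measure); or (C′₂) replace `0 ≤ η` by `0 < η` and discharge `η = 0`
inside STUB E3. The witness below misses both repaired statements.
-/

noncomputable section

namespace Summit.AtomisticToContinuum.HydrodynamicLimit.Cruxes.PolynomialCompression.DrefuteG2

open Set MeasureTheory Filter
open Literature.MathematicalPhysics.KineticTheory

/-- STUB E2b `stub_eosCesaro`, verbatim. -/
def StubEosCesaro : Prop :=
    ∀ (Rf : ℝ → ℝ) (r : ℝ), 0 < r → ContinuousOn Rf (Icc 0 r) → (∀ x ∈ Icc 0 r, 1 ≤ Rf x ∧ Rf x ≤ 2) →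
      ∀ η : ℝ, 0 ≤ η → η < r →
        (0 < η → ∀ δ : ℝ, 0 < δ → ∀ᶠ N : ℕ in atTop, ∀ m : ℕ, m ≤ N →
          |qN uniformProfile (η ^ (1 / 3 : ℝ)) N m - Rf (η * m / (N + 1))| ≤ δ) →
        Tendsto (fun N : ℕ => -(N : ℝ)⁻¹ * Real.log (hsFreeVolume η N)) atTop
          (nhds (∫ s in (0 : ℝ)..1, Real.log (Rf (η * s))))

/-- **STUB E2b is false as typed**: two constant `Rf`'s at `η = 0` force `0 = log 2`. [folklore] -/
theorem stubEosCesaro_false : ¬ StubEosCesaro := by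
  intro H
  have h1 := H (fun _ => 1) 1 one_pos continuousOn_const (fun x _ => ⟨le_rfl, by norm_num⟩) 0 le_rfl one_pos
    (fun h => absurd h (lt_irrefl 0))
  have h2 := H (fun _ => 2) 1 one_pos continuousOn_const (fun x _ => ⟨by norm_num, le_rfl⟩) 0 le_rfl one_pos
    (fun h => absurd h (lt_irrefl 0))
  have e := tendsto_nhds_unique h1 h2
  simp only [intervalIntegral.integral_const, sub_zero, smul_eq_mul, one_mul, Real.log_one] at e
  have : (0 : ℝ) < Real.log 2 := Real.log_pos one_lt_two
  linarith

/-- The repaired statement C′₁ (add `Rf 0 = 1`), for the record; believed true, not attempted here. -/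
def StubEosCesaroRepaired : Prop :=
    ∀ (Rf : ℝ → ℝ) (r : ℝ), 0 < r → ContinuousOn Rf (Icc 0 r) → (∀ x ∈ Icc 0 r, 1 ≤ Rf x ∧ Rf x ≤ 2) →
      Rf 0 = 1 →
      ∀ η : ℝ, 0 ≤ η → η < r →
        (0 < η → ∀ δ : ℝ, 0 < δ → ∀ᶠ N : ℕ in atTop, ∀ m : ℕ, m ≤ N →
          |qN uniformProfile (η ^ (1 / 3 : ℝ)) N m - Rf (η * m / (N + 1))| ≤ δ) →
        Tendsto (fun N : ℕ => -(N : ℝ)⁻¹ * Real.log (hsFreeVolume η N)) atTop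
          (nhds (∫ s in (0 : ℝ)..1, Real.log (Rf (η * s))))

end Summit.AtomisticToContinuum.HydrodynamicLimit.Cruxes.PolynomialCompression.DrefuteG2

end
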